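import Literature.Topology.FourManifolds.MorseCountClosed
import Literature.Topology.FourManifolds.SliceGenusDiscMorseProofs
import HarnessLib

/-!
# The Morse count of any Morse function on a closed manifold is palindromic (χ = 0 in odd dimension)

Topic `Literature/Topology/FourManifolds`; infrastructure for the fact seat
`provefact-Literature.Topology.FourManifolds.exists_isBalancedGKTrisection` (Gay–Kirby 2016,
Thm. 4 via §4, Lemma 14: the two handlebodies of the Heegaard splitting of `∂X₁` adapted to the
attaching link have the same genus).  Everything in this file is **proved**; no definitions, no
named facts.

`MorseCountClosed.lean` proves the palindromic symmetry
`Σₖ (-1)ᵏ #Critₖ(f) = Σₖ (-1)ᵏ #Crit_{dim - k}(f)` for **self-indexing** Morse functions on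
closed manifolds (through nice Morse functions on the cobordism `(X; ∅, ∅)`).  Here the same is
derived for **every** Morse function on a closed manifold (`IsMorse.morseCount_palindrome`), from
the Morse equality for arbitrary Morse functions on cobordisms
(`Cobordism.IsMorseFunction.morseEuler`, `SliceGenusDiscMorseProofs.lean`: Milnor 1963, §5 /
Milnor 1965, Thm. 7.4 after the rearrangement Thm. 4.8) applied to the renormalised function
`g = A f + B ∈ (0, 1)` and to the turned-about `1 - g` (Hirsch 1976, Ch. 6 §3, proof of Thm. 3.6).
In dimension `3` (`IsMorse.morseCount_three`): `c₀ - c₁ + c₂ - c₃ = 0`, i.e. for a Morse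
function ordered at a regular level `b` (indices `≤ 1` below, `≥ 2` above) the genera
`c₁ - c₀ + 1` of `{φ ≤ b}` and `c₂ - c₃ + 1` of `{b ≤ φ}` agree.

## References

* M. W. Hirsch, *Differential Topology* (1976), Ch. 6 §3, Thms. 3.5–3.6. [HirschDT1976]
* J. Milnor, *Lectures on the h-cobordism theorem* (1965), proof of Thm. 9.1 (turning about),
  Thm. 7.4. [MilnorHCobordism1965]
* D. Gay, R. Kirby, *Trisecting 4-manifolds*, Geom. Topol. 20 (2016), §4, Lemma 14. [GayKirby2016]
-/

open Set Function Filter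
open scoped Manifold ContDiff Topology

noncomputable section

namespace Literature.Topology.FourManifolds

universe u

open HalfSpaceCharted Literature.AlgebraicTopology.SingularHomology

variable {n : ℕ} {X : Type u} [TopologicalSpace X] [T2Space X] [SecondCountableTopology X]
  [CompactSpace X] [ChartedSpace (EuclideanSpace ℝ (Fin (n + 1))) X] [IsManifold (𝓡 (n + 1)) ∞ X]

/-- **A Morse function on a closed manifold, renormalised into `(0, 1)`, is a Morse function on
the cobordism `(X; ∅, ∅)`** with the same numbers of critical points of each index: with
`m ≤ f ≤ m'` (compactness), `g = (f - m + 1)/(m' - m + 2)`. [cite: MilnorHCobordism1965, Def. 3.1 (the case V = V' = ∅)] -/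
theorem IsMorse.exists_isMorseFunction_ofClosed [Nonempty X] {f : X → ℝ} (hf : IsMorse (𝓡 (n + 1)) f) :
    ∃ (A B : ℝ), 0 < A ∧
      (Cobordism.ofClosed n X).IsMorseFunction ((fun x => A * f x + B) ∘ of.symm) ∧
      ∀ k, (criticalSetOfIndex (𝓡∂ (n + 1)) (M := (Cobordism.ofClosed n X).W)
          ((fun x => A * f x + B) ∘ of.symm) k).ncard =
        (criticalSetOfIndex (𝓡 (n + 1)) f k).ncard := by
  have hc : Continuous f := hf.contMDiff.continuous
  obtain ⟨x₀, -, hx₀⟩ := isCompact_univ.exists_isMinOn univ_nonempty hc.continuousOn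
  obtain ⟨x₁, -, hx₁⟩ := isCompact_univ.exists_isMaxOn univ_nonempty hc.continuousOn
  set m := f x₀
  set m' := f x₁
  have hmm : m ≤ m' := hx₀ (mem_univ x₁)
  set A : ℝ := 1 / (m' - m + 2) with hA
  set B : ℝ := (1 - m) / (m' - m + 2) with hB
  have hD : 0 < m' - m + 2 := by linarith
  have hApos : 0 < A := by positivity
  set f₁ : X → ℝ := fun x => A * f x + B with hf₁
  have hf₁M : IsMorse (𝓡 (n + 1)) f₁ := hf.const_mul_add hApos.ne' _
  have hf₁2 : ContMDiff (𝓡 (n + 1)) 𝓘(ℝ, ℝ) 2 f₁ := hf₁M.contMDiff.of_le (by norm_cast)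
  refine ⟨A, B, hApos, Cobordism.isMorseFunction_ofClosed_iff.2 ⟨hf₁M, fun x => ?_⟩, fun k => ?_⟩
  · have h0 : m ≤ f x := hx₀ (mem_univ x)
    have h1 : f x ≤ m' := hx₁ (mem_univ x)
    have heq : A * f x + B = (f x - m + 1) / (m' - m + 2) := by
      simp only [hA, hB]; ring
    rw [heq]
    constructor
    · exact div_pos (by linarith) hD
    · rw [div_lt_one hD]; linarith
  · show (criticalSetOfIndex (𝓡∂ (n + 1)) (f₁ ∘ of.symm) k).ncard = _
    rw [ncard_criticalSetOfIndex_eq hf₁2, hf.criticalSetOfIndex_const_mul_add hApos]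

/-- **The Morse count of a closed manifold is palindromic, for every Morse function**:
`Σ_{k ≤ dim X} (-1)ᵏ #Critₖ(f) = Σ_{k ≤ dim X} (-1)ᵏ #Crit_{dim X - k}(f)` — both sides equal
`Σᵢ (-1)ⁱ rank H_i(X; ℤ)` by the Morse equality (`Cobordism.IsMorseFunction.morseEuler`) for the
renormalised function on `(X; ∅, ∅)` and for its turned-about `1 - g`, whose critical points of
index `k` are those of `g` of index `dim - k` (Hirsch 1976, Ch. 6 §3, proof of Thm. 3.6:
"`ν_k(f) = ν_{n-k}(-f)`"; Milnor 1965, proof of Thm. 9.1).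
[cite: HirschDT1976, Ch. 6 §3, Thms. 3.5–3.6 (PDF p. 151)] [cite: MilnorHCobordism1965, proof of Thm. 9.1] -/
theorem IsMorse.morseCount_palindrome {f : X → ℝ} (hf : IsMorse (𝓡 (n + 1)) f) :
    ∑ k ∈ Finset.range (n + 2), (-1 : ℤ) ^ k * ((criticalSetOfIndex (𝓡 (n + 1)) f k).ncard : ℤ) =
      ∑ k ∈ Finset.range (n + 2),
        (-1 : ℤ) ^ k * ((criticalSetOfIndex (𝓡 (n + 1)) f (n + 1 - k)).ncard : ℤ) := by
  rcases isEmpty_or_nonempty X with hX | hX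
  · have h0 : ∀ k, criticalSetOfIndex (𝓡 (n + 1)) f k = ∅ := fun k => Set.eq_empty_of_isEmpty _
    simp [h0]
  obtain ⟨A, B, hA, hg, hcount⟩ := hf.exists_isMorseFunction_ofClosed
  set g : (Cobordism.ofClosed n X).W → ℝ := (fun x => A * f x + B) ∘ of.symm with hgdef
  -- both counts equal the Euler characteristic of `X`
  have h1 := hg.morseEuler
  have h2 : ∑ i ∈ Finset.range (n + 2), (-1 : ℤ) ^ i *
      (Module.finrank ℤ (relativeSingularHomology ℤ ℤ (Cobordism.ofClosed n X).W
        (range (Cobordism.ofClosed n X).inl) i) : ℤ) =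
      ∑ k ∈ Finset.range (n + 2),
        (-1 : ℤ) ^ k * ((criticalSetOfIndex (𝓡∂ (n + 1)) (fun z => 1 - g z) k).ncard : ℤ) :=
    hg.symm.morseEuler.symm
  have h3 : ∀ k ∈ Finset.range (n + 2),
      (criticalSetOfIndex (𝓡∂ (n + 1)) (fun z => 1 - g z) k).ncard =
        (criticalSetOfIndex (𝓡 (n + 1)) f (n + 1 - k)).ncard := fun k hk => by
    rw [hg.criticalSetOfIndex_one_sub (by simpa [Nat.lt_succ_iff] using hk), hcount]
  calc _ = ∑ k ∈ Finset.range (n + 2), (-1 : ℤ) ^ k *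
        ((criticalSetOfIndex (𝓡∂ (n + 1)) g k).ncard : ℤ) :=
          Finset.sum_congr rfl fun k _ => by rw [hcount k]
    _ = _ := h1
    _ = _ := h2
    _ = _ := Finset.sum_congr rfl fun k hk => by rw [h3 k hk]

/-- **Dimension three: `c₀ - c₁ + c₂ - c₃ = 0`** for every Morse function on a closed
`3`-manifold (`χ(Y³) = 0`, Hirsch 1976, Ch. 6 §3, Thm. 3.6, from the palindromic symmetry).
[cite: HirschDT1976, Ch. 6 §3, Thm. 3.6 (PDF p. 151)] -/
theorem IsMorse.morseCount_three {Y : Type u} [TopologicalSpace Y] [T2Space Y]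
    [SecondCountableTopology Y] [CompactSpace Y] [ChartedSpace (EuclideanSpace ℝ (Fin 3)) Y]
    [IsManifold (𝓡 3) ∞ Y] {f : Y → ℝ} (hf : IsMorse (𝓡 3) f) :
    ((criticalSetOfIndex (𝓡 3) f 0).ncard : ℤ) - (criticalSetOfIndex (𝓡 3) f 1).ncard +
      (criticalSetOfIndex (𝓡 3) f 2).ncard - (criticalSetOfIndex (𝓡 3) f 3).ncard = 0 := by
  have h := IsMorse.morseCount_palindrome (n := 2) hf
  simp only [Finset.sum_range_succ, Finset.sum_range_zero] at h
  norm_num at h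
  linarith

/-- **The two handlebodies of an ordered Morse function on a closed `3`-manifold have the same
genus.**  If every critical point below `b` has index `≤ 1` and
every critical point above `b` has index `≥ 2`, then
`#Crit₁ ∩ {f ≤ b} + 1 - #Crit₀ ∩ {f ≤ b} = #Crit₂ ∩ {b ≤ f} + 1 - #Crit₃ ∩ {b ≤ f}` (as an
identity of integers: `c₁ - c₀ = c₂ - c₃`), the genera of `{f ≤ b}` and `{b ≤ f}`
(`TrisectionsHandleCounts.lean`).  This is the genus bookkeeping of the Heegaard splitting of
Gay–Kirby's Lemma 14. [cite: GayKirby2016, §4, Lemma 14] [cite: HirschDT1976, Ch. 6 §3, Thm. 3.6 (PDF p. 151)] -/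
theorem IsMorse.ncard_inter_sub_eq_of_ordered {Y : Type u} [TopologicalSpace Y] [T2Space Y]
    [SecondCountableTopology Y] [CompactSpace Y] [ChartedSpace (EuclideanSpace ℝ (Fin 3)) Y]
    [IsManifold (𝓡 3) ∞ Y] {f : Y → ℝ} (hf : IsMorse (𝓡 3) f) {b : ℝ}
    (hbelow : ∀ z, IsMCriticalPt (𝓡 3) f z → f z < b → morseIndex (𝓡 3) f z ≤ 1)
    (habove : ∀ z, IsMCriticalPt (𝓡 3) f z → b < f z → 2 ≤ morseIndex (𝓡 3) f z) :
    ((criticalSetOfIndex (𝓡 3) f 1 ∩ f ⁻¹' Iic b).ncard : ℤ) -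
        (criticalSetOfIndex (𝓡 3) f 0 ∩ f ⁻¹' Iic b).ncard =
      ((criticalSetOfIndex (𝓡 3) f 2 ∩ f ⁻¹' Ici b).ncard : ℤ) -
        (criticalSetOfIndex (𝓡 3) f 3 ∩ f ⁻¹' Ici b).ncard := by
  -- below `b` the sets of index `0, 1` are everything; above `b` those of index `2, 3`
  have hlow : ∀ i ≤ 1, criticalSetOfIndex (𝓡 3) f i ∩ f ⁻¹' Iic b = criticalSetOfIndex (𝓡 3) f i := by
    intro i hi
    refine inter_eq_left.2 fun z hz => ?_
    obtain ⟨hzc, hzi⟩ := hz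
    simp only [mem_preimage, mem_Iic]
    by_contra hlt
    have := habove z hzc (not_le.1 hlt)
    omega
  have hhigh : ∀ i, 2 ≤ i → criticalSetOfIndex (𝓡 3) f i ∩ f ⁻¹' Ici b = criticalSetOfIndex (𝓡 3) f i := by
    intro i hi
    refine inter_eq_left.2 fun z hz => ?_
    obtain ⟨hzc, hzi⟩ := hz
    simp only [mem_preimage, mem_Ici]
    by_contra hlt
    have := hbelow z hzc (not_le.1 hlt)
    omega
  rw [hlow 1 le_rfl, hlow 0 (Nat.zero_le _), hhigh 2 le_rfl, hhigh 3 (by norm_num)]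
  have h := hf.morseCount_three
  linarith

end Literature.Topology.FourManifolds

end
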